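import Summits.QuantumFields.YangMills.Theorems.BalabanUVNodesN09ChartReadAveragingSubmersion
import Literature.MeasureTheory.Integral.AnalyticSubmersionSharpDensity
import Mathlib.Analysis.Normed.Module.HahnBanach
import HarnessLib

/-!
# BalabanUVNodes ∕ N09 — (M3r)-LOCAL, SHARP EDITION: THE CHART-READ (0.4) AVERAGE IS REAL-ANALYTIC AT `0` ON THE GUARD, AND dag-n09-w2's SHARP ENGINE (p613264) APPLIED TO IT —
# the flat local Jacobian face with a (displayed) transverse analytic threshold; plus the generic fact that OFF the threshold set the transversality datum is free

Cell `pub-ymgap`, width seat `pub-ymgap-dag-n09-w4` generation 5 (HUMAN RULING D-0149; DAG node N09 = [Balaban1987RG1] §§2–5; INBOX CLAIM-1 l.32428, CLAIM-2∕INTENT-3 l.35188,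
DECL-DELTA l.35297).  `--kind proof --supports stmt-QuantumFields-27364 --as helper` (K1⁹ `StabilityBRunRowsAtRecordR13SepCoPHV`, rev 29; lineage of the K1⁸ 26907 helpers; count-neutral; theorems only, 0 def ∕ 0 instance ∕ 0 notation ∕ 0 sorry).  Files 1–2 of the lane:
`…N09ChartReadAveragingSmooth` (p620237), `…N09ChartReadAveragingSubmersion` (p621434).

WHY.  Files 1–2 closed the local route for densities CONTINUOUS on the guard (idle exemption).  The record's density `ρ_k χ_k` carries the SHARP (2.9) cut-off; dag-n09-w2's SHARP engine
`AnalyticSubmersion.exists_continuousOn_density_map_of_analytic_submersion_sharp` (p613264) asks the chart-read map REAL-ANALYTIC at `0` with onto differential, plus an analytic threshold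
`g` transverse to the fibre.  THIS FILE supplies the analytic-submersion half — §1: file 1's `ContDiffAt ℝ ⊤` is stated at Mathlib's exponent `⊤ = ω`, so `ψ_{U₀}` IS analytic
(`ContDiffAt.analyticAt`); §2: the engine applied, the threshold data `(g, hgan, htr)` DISPLAYED in p613264's own shape; §2b: OFF the threshold set those data are FREE (`g := g₀·ℓ` with
`g₀(0) ≠ 0`, `ℓ` a Hahn–Banach dual vector of a fibre direction).  The downstream transport ∕ gluing ∕ record doors with exemptions, the CORNER (finite-family) engine and the sharp-form
bookkeeping are dag-n09-w2 g4's announced INTENT-8…12 (INBOX l.≈35240, 09:21Z — earlier than this file's INTENT-3; my draft §3–§5 twins are WITHDRAWN in their favour); the (2.9) threshold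
functionals' analytic charts and transversality are the (F2)-fibre lanes' objects.  Nothing of theirs is restated here.

CONTENTS (CONSUMED BY NAME, nothing modified: files 1–2; p613264; `BlockAveraging.measurable_avgFun`; Mathlib `ContDiffAt.analyticAt`, `exists_dual_vector`, `Measure.pi.isAddHaarMeasure`).
§1 ★★ `analyticAt_chartRead_avgFun`.  §2 ★★★ `sharpEngineFace_chartRead_avgFun`.  §2b ★ `exists_transverse_threshold_of_apply_ne_zero` (generic).

DISPLAYED HYPOTHESES.  Standing range; the loop α-guard (`dist1 (loopHol U₀ c i) ≤ α`, `α ≤ 1∕24`, `α < δ_N`, `157·α < L^{1−d}`); in §2: `g` with `AnalyticAt ℝ g 0` and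
`∃ v ∈ ker Dψ_{U₀}(0), Dg(0) v ≠ 0` (inhabitable at support points on at most ONE non-degenerate threshold hypersurface and — §2b — everywhere off the threshold set; NOT at corners, where
dag-n09-w2's finite-family engine is the tool).

HONEST FRAMING.  LOCATED, count-neutral; one `exact` over p613264 + one generic lemma; NO chart of Bałaban's constructed ((2.10) untouched), NO estimate; the (2.9) thresholds' analytic chart +
transversality NOT proved here; `hreg` at the record's sharp density NOT discharged; N09 NOT discharged; conjunct 1 (Lemma 4) ∕ FLAG №7 untouched; K0⁷ ∕ K1⁸ ∕ K3⁷ NOT closed; counts unmoved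
(typed 28∕28 · discharged 5∕28); no summit statement is proved here; R4 = the conditional finite-𝕋⁴ rung `BalabanLadder.UV` only — NOT continuum ∕ ℝ⁴ ∕ OS; the Yang–Mills mass gap (Clay) is
NOT proved by any of this.
-/

noncomputable section

open scoped Matrix.Norms.L2Operator Topology ENNReal ContDiff
open Filter Set Function MeasureTheory

namespace Summit.QuantumFields.YangMills.BalabanUVNodes.N09ChartReadAveragingSharp

open Literature.MathematicalPhysics.QuantumFieldTheory.Balaban1983to89
open Literature.MathematicalPhysics.QuantumFieldTheory.Balaban1983to89.HaarExponentialChart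
open Literature.MathematicalPhysics.QuantumFieldTheory.Balaban1983to89.HaarExponentialChart.IsChartRep
open Literature.MathematicalPhysics.QuantumFieldTheory.Balaban1983to89.BlockAveraging (Small Idx avgFun loopHol)
open Literature.MathematicalPhysics.QuantumFieldTheory.Balaban1983to89.ExpMeanLog (expMeanLogSU deltaSU)
open Literature.MathematicalPhysics.QuantumFieldTheory.Balaban1983to89.Node00
open Summit.QuantumFields.YangMills.BalabanUVNodes.N09ChartReadAveragingSmooth
open Summit.QuantumFields.YangMills.BalabanUVNodes.N09ChartReadAveragingSubmersion

/-! ## §1  Analyticity (the tree's `ContDiffAt ℝ ⊤` IS `C^ω`) -/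

section Analytic

variable {P : Params} {j : ℕ} {N : ℕ} [NeZero N]
variable (U₀ : GaugeField P j (SU N))

/-- ★★ **THE CHART-READ (0.4) AVERAGE IS REAL-ANALYTIC AT `0` ON THE GUARD** (file 1's `contDiffAt_chartRead_avgFun` is stated at the exponent `⊤ = ω` of Mathlib's `WithTop ℕ∞`, i.e. it IS
the analytic class; `ContDiffAt.analyticAt`). [cite: Balaban1987RG1, (0.4) p.253, p.253 («we assume that it is an analytic function»)] -/
theorem analyticAt_chartRead_avgFun (hsmall : ∀ c, Small (expMeanLogSU (n := Fin N)) U₀ c) :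
    AnalyticAt ℝ (fun (A : PBond P j → (specialUnitaryLogChart (Fin N)).lie) (c : PBond P (j + 1)) =>
      (isChartRep_specialUnitaryGroup (n := Fin N)).logChart
        (avgFun (expMeanLogSU (n := Fin N)) (fun b => (isChartRep_specialUnitaryGroup (n := Fin N)).expChart (A b) * U₀ b) c *
          (avgFun (expMeanLogSU (n := Fin N)) U₀ c)⁻¹)) 0 :=
  (contDiffAt_chartRead_avgFun (P := P) (j := j) U₀ hsmall).analyticAt

end Analytic

/-! ## §2  The SHARP engine applied (displayed: an analytic threshold chart `g` at `U₀`, transverse to the fibre of `Dψ_{U₀}(0)`) -/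

section Sharp

variable {P : Params} {j : ℕ} {N : ℕ} [NeZero N]
variable (U₀ : GaugeField P j (SU N))
variable [MeasurableSpace (specialUnitaryLogChart (Fin N)).lie] [BorelSpace (specialUnitaryLogChart (Fin N)).lie]
  (η : Measure (specialUnitaryLogChart (Fin N)).lie) [η.IsAddHaarMeasure]

/-- ★★★ **(M3r)-LOCAL, SHARP ENGINE FORM.**  Under the loop α-guard at `U₀` (standing range), for every real function `g` on the chart `𝔰𝔲(N)^{B_j}` ANALYTIC at `0` and TRANSVERSE
to the averaging fibre (`Dg(0)` does not vanish on `ker Dψ_{U₀}(0)`): open windows `O ∋ 0`, `D ∋ ψ_{U₀}(0)` such that every measurable `r ≥ 0` bounded on `O`, zero off `O`, and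
continuous at each `A ∈ O` with `g A ≠ 0` has under `ψ_{U₀}` a push-forward density w.r.t. `⊗η` CONTINUOUS on `D` — dag-n09-w2's
`AnalyticSubmersion.exists_continuousOn_density_map_of_analytic_submersion_sharp` over §1 + file 2's `fderiv_chartRead_avgFun_range_eq_top`.
[cite: Balaban1987RG1, (2.1)–(2.10) pp.265–267; EvansGariepy1992, §3.4.3 Thm 2; Mityagin2015, Prop. 1] -/
theorem sharpEngineFace_chartRead_avgFun (hj : j + 1 ≤ P.m + P.K) {α : ℝ} (hα : ∀ c i, dist1 (loopHol U₀ c i) ≤ α) (hα24 : α ≤ 1 / 24)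
    (hαδ : α < deltaSU (Fin N)) (hαL : 157 * α < ((P.L : ℝ) ^ (P.d - 1))⁻¹)
    {g : (PBond P j → (specialUnitaryLogChart (Fin N)).lie) → ℝ} (hgan : AnalyticAt ℝ g 0)
    (htr : ∃ v ∈ LinearMap.ker ((fderiv ℝ (fun (A : PBond P j → (specialUnitaryLogChart (Fin N)).lie) (c : PBond P (j + 1)) =>
      (isChartRep_specialUnitaryGroup (n := Fin N)).logChart
        (avgFun (expMeanLogSU (n := Fin N)) (fun b => (isChartRep_specialUnitaryGroup (n := Fin N)).expChart (A b) * U₀ b) c *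
          (avgFun (expMeanLogSU (n := Fin N)) U₀ c)⁻¹)) 0 :
        (PBond P j → (specialUnitaryLogChart (Fin N)).lie) →L[ℝ] (PBond P (j + 1) → (specialUnitaryLogChart (Fin N)).lie)) :
        (PBond P j → (specialUnitaryLogChart (Fin N)).lie) →ₗ[ℝ] (PBond P (j + 1) → (specialUnitaryLogChart (Fin N)).lie)),
      fderiv ℝ g 0 v ≠ 0) :
    ∃ O : Set (PBond P j → (specialUnitaryLogChart (Fin N)).lie), IsOpen O ∧ (0 : PBond P j → (specialUnitaryLogChart (Fin N)).lie) ∈ O ∧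
      ∃ D : Set (PBond P (j + 1) → (specialUnitaryLogChart (Fin N)).lie), IsOpen D ∧
      (fun (A : PBond P j → (specialUnitaryLogChart (Fin N)).lie) (c : PBond P (j + 1)) =>
        (isChartRep_specialUnitaryGroup (n := Fin N)).logChart
          (avgFun (expMeanLogSU (n := Fin N)) (fun b => (isChartRep_specialUnitaryGroup (n := Fin N)).expChart (A b) * U₀ b) c *
            (avgFun (expMeanLogSU (n := Fin N)) U₀ c)⁻¹)) 0 ∈ D ∧
      ∀ r : (PBond P j → (specialUnitaryLogChart (Fin N)).lie) → ℝ, Measurable r → (∀ A, 0 ≤ r A) → (∀ A ∈ O, g A ≠ 0 → ContinuousAt r A) →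
        (∃ C₀ : ℝ, ∀ A ∈ O, r A ≤ C₀) → (∀ A, A ∉ O → r A = 0) →
        ∃ I : (PBond P (j + 1) → (specialUnitaryLogChart (Fin N)).lie) → ℝ, ContinuousOn I D ∧ (∀ w, 0 ≤ I w) ∧
          ∀ A' : Set (PBond P (j + 1) → (specialUnitaryLogChart (Fin N)).lie), MeasurableSet A' → A' ⊆ D →
            ((Measure.pi fun _ : PBond P j => η).withDensity fun A => ENNReal.ofReal (r A))
                ((fun (A : PBond P j → (specialUnitaryLogChart (Fin N)).lie) (c : PBond P (j + 1)) =>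
                  (isChartRep_specialUnitaryGroup (n := Fin N)).logChart
                    (avgFun (expMeanLogSU (n := Fin N)) (fun b => (isChartRep_specialUnitaryGroup (n := Fin N)).expChart (A b) * U₀ b) c *
                      (avgFun (expMeanLogSU (n := Fin N)) U₀ c)⁻¹)) ⁻¹' A') =
              ∫⁻ w in A', ENNReal.ofReal (I w) ∂(Measure.pi fun _ : PBond P (j + 1) => η) := by
  haveI : (Measure.pi fun _ : PBond P j => η).IsAddHaarMeasure := Measure.pi.isAddHaarMeasure _
  haveI : (Measure.pi fun _ : PBond P (j + 1) => η).IsAddHaarMeasure := Measure.pi.isAddHaarMeasure _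
  have hsmall : ∀ c, Small (expMeanLogSU (n := Fin N)) U₀ c := fun c i => lt_of_le_of_lt (hα c i) hαδ
  exact Literature.MeasureTheory.Integral.AnalyticSubmersion.exists_continuousOn_density_map_of_analytic_submersion_sharp
    (Measure.pi fun _ : PBond P j => η) (Measure.pi fun _ : PBond P (j + 1) => η)
    (measurable_chartRead_avgFun (P := P) (j := j) U₀)
    (analyticAt_chartRead_avgFun (P := P) (j := j) U₀ hsmall)
    (fderiv_chartRead_avgFun_range_eq_top (P := P) (j := j) hj hα hα24 hαδ hαL) hgan htr

end Sharp

/-! ## §2b  The displayed threshold data are FREE AWAY FROM THE THRESHOLD SET: a global threshold-detecting chart `g₀` with `g₀(0) ≠ 0` times a linear functional is transverse -/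

section OffThreshold

variable {E : Type*} [NormedAddCommGroup E] [NormedSpace ℝ E]

/-- **OFF THE THRESHOLD, TRANSVERSALITY IS AUTOMATIC.**  Let `g₀ : E → ℝ` be analytic at `0` with `g₀ 0 ≠ 0`, let `S` be any set with `{g₀ ≠ 0} ⊆ S` (the exempt set), and let `v ≠ 0` lie in a
subspace `Kr` (the fibre `ker Dψ(0)`).  Then `g := g₀ · ℓ`, `ℓ` a norm-one functional with `ℓ v = ‖v‖` (Hahn–Banach), is analytic at `0`, satisfies `{g ≠ 0} ⊆ S`, and `Dg(0) v = g₀(0)·‖v‖ ≠ 0` —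
the displayed threshold data of §2∕§4∕§5 at every support point NOT on the threshold set (there `g₀(0) ≠ 0`); ON the threshold set genuine transversality is needed, and at CORNER points
(two threshold hypersurfaces) no single transverse `g` exists — a product edition of the engine is the located successor. [folklore] -/
theorem exists_transverse_threshold_of_apply_ne_zero {g₀ : E → ℝ} (hg₀ : AnalyticAt ℝ g₀ 0) (h0 : g₀ 0 ≠ 0) {S : Set E}
    (hS : ∀ x, g₀ x ≠ 0 → x ∈ S) (Kr : Submodule ℝ E) {v : E} (hvK : v ∈ Kr) (hv : v ≠ 0) :
    ∃ g : E → ℝ, AnalyticAt ℝ g 0 ∧ (∃ w ∈ Kr, fderiv ℝ g 0 w ≠ 0) ∧ ∀ x, g x ≠ 0 → x ∈ S := by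
  obtain ⟨ℓ, -, hℓv⟩ := exists_dual_vector ℝ v (norm_ne_zero_iff.2 hv)
  refine ⟨fun x => g₀ x * ℓ x, hg₀.mul (ℓ.analyticAt 0), ⟨v, hvK, ?_⟩, fun x hx => hS x (left_ne_zero_of_mul hx)⟩
  have hd : HasFDerivAt (fun x => g₀ x * ℓ x) (g₀ 0 • (ℓ : E →L[ℝ] ℝ) + ℓ 0 • fderiv ℝ g₀ 0) 0 :=
    hg₀.differentiableAt.hasFDerivAt.mul ℓ.hasFDerivAt
  rw [hd.fderiv, map_zero, zero_smul, add_zero]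
  show g₀ 0 • ℓ v ≠ 0
  rw [hℓv, smul_eq_mul]
  exact mul_ne_zero h0 (norm_ne_zero_iff.2 hv)

end OffThreshold


end Summit.QuantumFields.YangMills.BalabanUVNodes.N09ChartReadAveragingSharp
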